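import Mathlib
import HarnessLib
import Literature.Combinatorics.HironakaPolyhedraGame.Spivakovsky1983Derived

/-!
# Spivakovsky's Lemmas 1, 2 (a)(b)(c), 3 on generators (part 3/4)

Source: [Spivakovsky1983] §III, pp. 422–431.  ON GENERATORS (see `Spivakovsky1983Invariant.lean`):

* **Lemma 1** ((a) ⇒ (b)): if `Γ₁ ⊆ I₁` is permissible for `Δ₁` then `Γ = S ∪ Γ₁` is permissible for
  `Δ` and `d_Γ(Δ̃) = d(Δ̃)` — stated for any coordinate set `S` (`isPermissible_liftMove`); with
  `Γ₁ = ∅` and `Δ₁ = ∅` it is the case `Δ_r = ∅` of the Corollary;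
* the derived position is empty or a position, and it is NOT WON while `Δ` is not won (so the minimal
  permissible `Γ_r` of §II exists);
* **Lemma 2 (a)** `d(Δ̃') ≤ d(Δ̃)`; **(b)** equality forces `i ∉ S(Δ)` and `S(Δ) ⊆ S(Δ')`;
  **(c)** at constant `d(Δ̃)`, for `Γ = S ∪ Γ₁` and `i ∈ I₁`: `Δ'₁ = [σ_{Γ₁,i}(Δ₁)]` — here an EQUALITY
  OF FINITE GENERATING SETS, `derived S (σ_{Γ,i} A) = σ_{Γ₁,i}(derived S A)`, proved pointwise from the
  computations (3), (4) of pp. 425–426;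
* **Lemma 3** (orthant positions, `Δ = [ω]`): a permissible `Γ` minimal for inclusion (here: of
  minimal cardinality) has `Σ_{Γ∖i} ω < 1`, so `|ω|` drops by at least `1/N` and `Δ'` is again an
  orthant; by induction on `N|ω|` player A WINS from every orthant position (`aWins_of_omega_mem`).

No new definitions.  Part 4: `Spivakovsky1983Proof.lean`.
-/

namespace Literature.Combinatorics.HironakaPolyhedraGame

namespace Spivakovsky1983

open Finset

variable {n : ℕ}

/-! ## The derived position; Lemma 1 -/

/-- The derived position `Δ₁` is empty or again a position («It is easy to see that Δ₁ is again positively convex»). [cite: Spivakovsky1983, §I p. 421] -/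
theorem derived_eq_empty_or_isPosition {A : Finset (Fin n → ℚ)} (hA : IsPosition A)
    (S : Finset (Fin n)) :
    derived S A = ∅ ∨ IsPosition (derived S A) := by
  by_cases h : derived S A = ∅
  · exact Or.inl h
  · refine Or.inr ⟨Finset.nonempty_iff_ne_empty.2 h, ?_⟩
    intro y hy t
    obtain ⟨w, hw, hS, rfl⟩ := mem_derived.1 hy
    exact div_nonneg (genSet_nonneg hA hw _) (by linarith)

/-- **Lemma 1** [cite: Spivakovsky1983, p. 423], direction (a) ⇒ (b), on generators (any `S`). -/
theorem isPermissible_liftMove {A : Finset (Fin n → ℚ)} (hA : IsPosition A) (hd : 0 < dTilde A)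
    (S : Finset (Fin n)) {Γ₁ : Finset (Fin (Sᶜ.card))}
    (hΓ₁ : IsPermissible (derived S A) Γ₁) :
    IsPermissible A (liftMove S Γ₁) ∧ dTildeOn A (liftMove S Γ₁) = dTilde A := by
  constructor
  · intro a ha
    rw [sum_liftMove]
    by_cases hs : ∑ j ∈ S, a j < 1
    · have h1 := hΓ₁ _ (mem_derived_of (mem_genSet_left ha) hs)
      rw [sum_proj, le_div_iff₀ (by linarith), one_mul] at h1
      linarith
    · have h2 : 0 ≤ ∑ t ∈ Γ₁, a (enumCompl S t) :=
        Finset.sum_nonneg (fun t _ => hA.2 a ha _)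
      linarith
  · apply le_antisymm (dTildeOn_le_dTilde hA.1 _)
    obtain ⟨a, ha, hmin⟩ := exists_dTildeOn_eq hA.1 (liftMove S Γ₁)
    rw [← hmin, sum_liftMove]
    by_cases hs : ∑ j ∈ S, tilde A a j < dTilde A
    · have hs' : ∑ j ∈ S, (fun j => tilde A a j / dTilde A) j < 1 := by
        show ∑ j ∈ S, tilde A a j / dTilde A < 1
        rw [← Finset.sum_div, div_lt_one hd]
        exact hs
      have h1 := hΓ₁ _ (mem_derived_of (mem_genSet_right ha) hs')
      rw [sum_proj] at h1
      rw [← Finset.sum_div, ← Finset.sum_div, le_div_iff₀ (by rw [sub_pos, div_lt_one hd]; exact hs),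
        one_mul] at h1
      -- h1 : 1 - (∑ S ã)/d̃ ≤ (∑ Γ₁ ã∘e)/d̃
      rw [sub_le_iff_le_add, ← add_div, le_div_iff₀ hd, one_mul] at h1
      linarith
    · have h2 : 0 ≤ ∑ t ∈ Γ₁, tilde A a (enumCompl S t) :=
        Finset.sum_nonneg (fun t _ => tilde_nonneg ha _)
      linarith

/-- The derived position of a position that is not yet won is not won either (so a minimal permissible `Γ_r` exists in §II). [cite: Spivakovsky1983, §II p. 422; §III] -/
theorem not_won_derived {A : Finset (Fin n → ℚ)} (hW : ¬ Won A)
    (hd : 0 < dTilde A) : ¬ Won (derived (suppMin A) A) := by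
  rintro ⟨y, hy, hy1⟩
  set S := suppMin A with hSdef
  obtain ⟨w, hwg, hwS, rfl⟩ := mem_derived.1 hy
  have hden : 0 < 1 - ∑ j ∈ S, w j := by linarith
  rw [sum_proj_univ, div_le_one hden] at hy1
  have htot : ∑ j, w j ≤ 1 := by
    have := Finset.sum_add_sum_compl S w
    linarith
  rcases mem_genSet.1 hwg with hwA | ⟨a, ha, rfl⟩
  · exact hW ⟨w, hwA, htot⟩
  · simp only at htot hwS
    rw [← Finset.sum_div, div_le_one hd] at htot
    have hmin : ∑ j, tilde A a j = dTilde A := le_antisymm htot (dTildeOn_le ha univ)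
    have hS : ∑ j ∈ S, tilde A a j = ∑ j, tilde A a j := by
      apply Finset.sum_subset (Finset.subset_univ S)
      intro j _ hjS
      by_contra hne
      exact hjS (hSdef ▸ mem_suppMin.2 ⟨a, ha, hmin, hne⟩)
    rw [← Finset.sum_div, div_lt_one hd, hS, hmin] at hwS
    exact lt_irrefl _ hwS

/-! ## Lemma 2 -/

/-- **Lemma 2 (a)** [cite: Spivakovsky1983, p. 424]. -/
theorem dTilde_image_le {A : Finset (Fin n → ℚ)} (hA : IsPosition A) {Γ : Finset (Fin n)}
    (hΓ : dTildeOn A Γ = dTilde A) (i : Fin n) :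
    dTilde (A.image (gameMove Γ i)) ≤ dTilde A := by
  obtain ⟨a, ha, hmin⟩ := exists_dTildeOn_eq hA.1 univ
  have hmin' : ∑ j, tilde A a j = dTilde A := hmin
  have hΓa := sum_tilde_on_eq_of_min ha hmin' hΓ
  have hle := dTildeOn_le (Finset.mem_image_of_mem (gameMove Γ i) ha) univ
  have hsum := sum_tilde_image hA.1 Γ i a
  have hi := tilde_nonneg ha i
  unfold dTilde at *
  rw [hsum, hmin', hΓa, hΓ] at hle
  linarith

/-- **Lemma 2 (b)**, first half: a reply inside `S(Δ)` makes `d(Δ̃)` drop. [cite: Spivakovsky1983, §III Lemma 2 (b), p. 424] -/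
theorem dTilde_image_lt_of_mem_suppMin {A : Finset (Fin n → ℚ)} (hA : IsPosition A)
    {Γ : Finset (Fin n)} (hΓ : dTildeOn A Γ = dTilde A) {i : Fin n} (hi : i ∈ suppMin A) :
    dTilde (A.image (gameMove Γ i)) < dTilde A := by
  obtain ⟨a, ha, hmin, hne⟩ := mem_suppMin.1 hi
  have hΓa := sum_tilde_on_eq_of_min ha hmin hΓ
  have hle := dTildeOn_le (Finset.mem_image_of_mem (gameMove Γ i) ha) univ
  have hsum := sum_tilde_image hA.1 Γ i a
  have hpos : 0 < tilde A a i := lt_of_le_of_ne (tilde_nonneg ha i) (Ne.symm hne)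
  unfold dTilde at *
  rw [hsum, hmin, hΓa, hΓ] at hle
  linarith

/-- **Lemma 2 (b)**, second half: at constant `d(Δ̃)`, `S(Δ) ⊆ S(Δ')`. [cite: Spivakovsky1983, §III Lemma 2 (b), pp. 424–425] -/
theorem suppMin_subset_suppMin_image {A : Finset (Fin n → ℚ)} (hA : IsPosition A)
    {Γ : Finset (Fin n)} (hΓ : dTildeOn A Γ = dTilde A) {i : Fin n} (hi : i ∉ suppMin A)
    (hd : dTilde (A.image (gameMove Γ i)) = dTilde A) :
    suppMin A ⊆ suppMin (A.image (gameMove Γ i)) := by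
  intro j hj
  obtain ⟨a, ha, hmin, hne⟩ := mem_suppMin.1 hj
  have hji : j ≠ i := by rintro rfl; exact hi hj
  have hai : tilde A a i = 0 := by
    by_contra h
    exact hi (mem_suppMin.2 ⟨a, ha, hmin, h⟩)
  have hΓa := sum_tilde_on_eq_of_min ha hmin hΓ
  have hsum := sum_tilde_image hA.1 Γ i a
  refine mem_suppMin.2 ⟨gameMove Γ i a, Finset.mem_image_of_mem _ ha, ?_, ?_⟩
  · rw [hsum, hmin, hai, hΓa, hΓ, hd]; ring
  · rw [tilde_image_of_ne hA.1 Γ hji]; exact hne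

/-- **Lemma 2 (c)** [cite: Spivakovsky1983, pp. 424–426] as an equality of finite generating sets:
at constant `d(Δ̃)`, the derived position of `σ_{Γ,i}(Δ)` for `Γ = S ∪ Γ₁`, `i = i(t) ∉ S`, is
`σ_{Γ₁,t}` of the derived position. -/
theorem derived_image_gameMove {A : Finset (Fin n → ℚ)} (hA : IsPosition A) (hd : 0 < dTilde A)
    (S : Finset (Fin n)) (Γ₁ : Finset (Fin (Sᶜ.card))) (t : Fin (Sᶜ.card))
    (hΓ : dTildeOn A (liftMove S Γ₁) = dTilde A)
    (hd' : dTilde (A.image (gameMove (liftMove S Γ₁) (enumCompl S t))) = dTilde A) :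
    derived S (A.image (gameMove (liftMove S Γ₁) (enumCompl S t))) =
      (derived S A).image (gameMove Γ₁ t) := by
  classical
  set Γ := liftMove S Γ₁ with hΓdef
  set i := enumCompl S t with hidef
  have hiS : i ∉ S := enumCompl_not_mem S t
  -- sums over `S` are unchanged by `σ_{Γ,i}` (`i ∉ S`)
  have hsumS : ∀ w : Fin n → ℚ, ∑ j ∈ S, gameMove Γ i w j = ∑ j ∈ S, w j := by
    intro w
    refine Finset.sum_congr rfl (fun j hj => ?_)
    have hji : j ≠ i := by rintro rfl; exact hiS hj
    exact gameMove_apply_of_ne hji w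
  -- Claim (4) of the paper on generators: `(ã'/d̃) = σ_{Γ,i}(ã/d̃)`
  have hτ : ((fun a' j => tilde (A.image (gameMove Γ i)) a' j / dTilde (A.image (gameMove Γ i))) ∘
      gameMove Γ i) = (gameMove Γ i ∘ fun a j => tilde A a j / dTilde A) := by
    funext a j
    simp only [Function.comp_apply]
    rw [hd']
    by_cases hji : j = i
    · rw [hji, tilde_image_self hA.1 Γ i a, hΓ, gameMove_apply_self, ← Finset.sum_div]
      field_simp
    · rw [tilde_image_of_ne hA.1 Γ hji a, gameMove_apply_of_ne hji]
  -- Claim 1: the generating sets correspond under `σ_{Γ,i}`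
  have h1 : genSet (A.image (gameMove Γ i)) = (genSet A).image (gameMove Γ i) := by
    unfold genSet
    rw [Finset.image_union, Finset.image_image, Finset.image_image, hτ]
  -- Claim (3): `P_S ∘ σ_{Γ,i} = σ_{Γ₁,t} ∘ P_S` on `M_S`
  have h3 : ∀ w : Fin n → ℚ, ∑ j ∈ S, w j < 1 →
      proj S (gameMove Γ i w) = gameMove Γ₁ t (proj S w) := by
    intro w hw
    funext t'
    by_cases ht' : t' = t
    · rw [ht', gameMove_apply_self, sum_proj]
      simp only [proj]
      rw [hsumS, ← hidef, gameMove_apply_self, hΓdef, sum_liftMove]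
      have hc : 1 - ∑ j ∈ S, w j ≠ 0 := by linarith
      field_simp
      ring
    · have hne : enumCompl S t' ≠ i := fun h => ht' ((enumCompl S).injective h)
      rw [gameMove_apply_of_ne ht']
      simp only [proj]
      rw [hsumS, gameMove_apply_of_ne hne]
  -- assemble
  ext y
  rw [mem_derived, Finset.mem_image, h1]
  constructor
  · rintro ⟨w', hw', hS', rfl⟩
    obtain ⟨w, hw, rfl⟩ := Finset.mem_image.1 hw'
    rw [hsumS] at hS'
    exact ⟨proj S w, mem_derived_of hw hS', (h3 w hS').symm⟩
  · rintro ⟨y₀, hy₀, rfl⟩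
    obtain ⟨w, hw, hS, rfl⟩ := mem_derived.1 hy₀
    refine ⟨gameMove Γ i w, Finset.mem_image_of_mem _ hw, ?_, h3 w hS⟩
    rw [hsumS]; exact hS

/-! ## Lemma 3: orthant positions -/

/-- `σ_{Γ,i}(x)` is `x` with its `i`-th coordinate replaced. [cite: Spivakovsky1983, §I p. 420] -/
theorem gameMove_eq_update (Γ : Finset (Fin n)) (i : Fin n) (x : Fin n → ℚ) :
    gameMove Γ i x = Function.update x i ((∑ k ∈ Γ, x k) - 1) := by
  funext j
  simp only [gameMove, Function.update_apply]

/-- `|σ_{Γ,i}(x)| = |x| − x_i + (Σ_Γ x − 1)`. [cite: Spivakovsky1983, §III proof of Lemma 3, p. 431] -/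
theorem sum_gameMove (Γ : Finset (Fin n)) (i : Fin n) (x : Fin n → ℚ) :
    ∑ j, gameMove Γ i x j = ∑ j, x j - x i + (∑ k ∈ Γ, x k - 1) := by
  rw [gameMove_eq_update, Finset.sum_update_of_mem (Finset.mem_univ i),
    Finset.sdiff_singleton_eq_erase, Finset.sum_erase_eq_sub (Finset.mem_univ i)]
  ring

/-- A generator of a `(1/N)ℤ`-lattice set has `|a| ∈ (1/N)ℤ`. [cite: Spivakovsky1983, §III p. 432] -/
theorem exists_sum_eq_div {N : ℕ} {A : Finset (Fin n → ℚ)} (hL : IsLattice N A)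
    {a : Fin n → ℚ} (ha : a ∈ A) : ∃ z : ℤ, ∑ j, a j = z / N := by
  choose z hz using hL a ha
  refine ⟨∑ j, z j, ?_⟩
  rw [Finset.sum_congr rfl (fun j _ => hz j), ← Finset.sum_div]
  push_cast
  rfl

/-- **Lemma 3** [cite: Spivakovsky1983, p. 431] — orthant positions are won by player A: a
permissible `Γ` of minimal cardinality makes `|ω|` drop by at least `1/N`, and the new position is
again an orthant position with corner `σ_{Γ,i}(ω)`. -/
theorem aWins_of_omega_mem {N : ℕ} (hN : 0 < N) :
    ∀ (A : Finset (Fin n → ℚ)), IsPosition A → IsLattice N A → (fun j => omega A j) ∈ A →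
      AWins A := by
  classical
  have hN' : (0 : ℚ) < N := by exact_mod_cast hN
  suffices H : ∀ (M : ℕ) (A : Finset (Fin n → ℚ)), IsPosition A → IsLattice N A →
      (fun j => omega A j) ∈ A → (N : ℚ) * ∑ j, omega A j ≤ M → AWins A by
    intro A hA hL hω
    obtain ⟨z, hz⟩ := exists_sum_eq_div hL hω
    refine H z.toNat A hA hL hω ?_
    have hz' : ∑ j, omega A j = z / N := hz
    rw [hz', mul_div_cancel₀ _ hN'.ne']
    exact_mod_cast Int.self_le_toNat z
  intro M
  induction M with
  | zero =>
    intro A hA hL hω hM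
    refine AWins.of_won ⟨_, hω, ?_⟩
    by_contra h
    push Not at h
    have h1 : (N : ℚ) * 1 < N * ∑ j, omega A j := mul_lt_mul_of_pos_left h hN'
    push_cast at hM
    linarith
  | succ M ih =>
    intro A hA hL hω hM
    by_cases hW : Won A
    · exact AWins.of_won hW
    -- a permissible `Γ` of minimal cardinality
    have huniv : IsPermissible A univ := by
      intro a ha
      exact ((not_won_iff A).1 hW a ha).le
    set P := (Finset.univ : Finset (Finset (Fin n))).filter (fun Γ => IsPermissible A Γ) with hPdef
    have hP : P.Nonempty := ⟨univ, by rw [hPdef, Finset.mem_filter]; exact ⟨Finset.mem_univ _, huniv⟩⟩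
    obtain ⟨Γ, hΓP, hΓmin⟩ := Finset.exists_min_image P Finset.card hP
    have hΓ : IsPermissible A Γ := (Finset.mem_filter.1 hΓP).2
    have hΓne : Γ.Nonempty := by
      rw [Finset.nonempty_iff_ne_empty]
      rintro rfl
      obtain ⟨a, ha⟩ := hA.1
      have := hΓ a ha
      norm_num at this
    refine AWins.of_move Γ hΓne hΓ (fun i hi => ?_)
    have hA' : IsPosition (A.image (gameMove Γ i)) := isPosition_image_gameMove hA hΓ i
    have hL' : IsLattice N (A.image (gameMove Γ i)) := isLattice_image_gameMove hN hL Γ i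
    -- the new corner is `σ_{Γ,i}(ω)`
    have hdOn : dTildeOn A Γ = 0 := by
      apply le_antisymm
      · have h1 := dTildeOn_le hω Γ
        have h2 : ∑ j ∈ Γ, tilde A (fun j => omega A j) j = 0 :=
          Finset.sum_eq_zero (fun j _ => by simp [tilde])
        rw [h2] at h1
        exact h1
      · obtain ⟨a, ha, h⟩ := exists_dTildeOn_eq hA.1 Γ
        rw [← h]
        exact Finset.sum_nonneg (fun j _ => tilde_nonneg ha j)
    have hω' : (fun j => omega (A.image (gameMove Γ i)) j) = gameMove Γ i (fun j => omega A j) := by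
      funext j
      by_cases hji : j = i
      · rw [hji, omega_image_self hA.1 Γ i, hdOn, gameMove_apply_self]
        ring
      · rw [omega_image_of_ne hA.1 Γ hji, gameMove_apply_of_ne hji]
    have hω'mem : (fun j => omega (A.image (gameMove Γ i)) j) ∈ A.image (gameMove Γ i) := by
      rw [hω']
      exact Finset.mem_image_of_mem _ hω
    -- minimality: `Σ_{Γ ∖ i} ω < 1`
    have hlt : ∑ j ∈ Γ.erase i, omega A j < 1 := by
      by_contra hge
      push Not at hge
      have hperm' : IsPermissible A (Γ.erase i) := by
        intro a ha
        exact hge.trans (Finset.sum_le_sum (fun j _ => omega_le ha j))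
      have hmem : Γ.erase i ∈ P := by
        rw [hPdef, Finset.mem_filter]
        exact ⟨Finset.mem_univ _, hperm'⟩
      have h1 := hΓmin _ hmem
      have h2 := Finset.card_erase_lt_of_mem hi
      omega
    -- the measure drops
    have hsum' : ∑ j, omega (A.image (gameMove Γ i)) j =
        ∑ j, omega A j - omega A i + (∑ k ∈ Γ, omega A k - 1) := by
      have : ∑ j, omega (A.image (gameMove Γ i)) j =
          ∑ j, (fun j => omega (A.image (gameMove Γ i)) j) j := rfl
      rw [this, hω', sum_gameMove]
    have herase : ∑ k ∈ Γ.erase i, omega A k = ∑ k ∈ Γ, omega A k - omega A i :=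
      Finset.sum_erase_eq_sub hi
    have hdec : ∑ j, omega (A.image (gameMove Γ i)) j < ∑ j, omega A j := by
      rw [hsum']
      linarith
    obtain ⟨z', hz'⟩ := exists_sum_eq_div hL' hω'mem
    have hz'' : ∑ j, omega (A.image (gameMove Γ i)) j = z' / N := hz'
    refine ih _ hA' hL' hω'mem ?_
    rw [hz'', mul_div_cancel₀ _ hN'.ne']
    have hlt' : (z' : ℚ) < (M : ℚ) + 1 := by
      have h1 : (z' : ℚ) = N * ∑ j, omega (A.image (gameMove Γ i)) j := by
        rw [hz'', mul_div_cancel₀ _ hN'.ne']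
      have h2 := mul_lt_mul_of_pos_left hdec hN'
      push_cast at hM
      linarith
    have : z' < (M : ℤ) + 1 := by exact_mod_cast hlt'
    have : z' ≤ (M : ℤ) := by omega
    exact_mod_cast this

end Spivakovsky1983

end Literature.Combinatorics.HironakaPolyhedraGame
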